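import Literature.NumberTheory.LFunctions.KMVMomentAsymptoticsBeyondDiagonal
import Literature.NumberTheory.LFunctions.KMVFirstMomentBeyondDiagonal
import Literature.NumberTheory.LFunctions.KowalskiMichelPeterssonFormula
import Literature.NumberTheory.LFunctions.KMVMomentsToHalfEdge
import Literature.NumberTheory.LFunctions.KMVMollifierPositivityFloor
import Summits.Parity.GeneralizedHardyLittlewood.Theses.PrimeLevelFamEdge
import HarnessLib

/-!
# Route `PrimeLevelFamEdge` — TYPED IDEA DELTAS, deck 14d: `negation` lens — K-L20-3 «THE ROGUE FORM», part 1: the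
# TABLE WORLD, the DICTIONARY `momentsBeyondDiagonal_iff`, and obstruction (O1) «K_A ⇒ the single-form mollified bound»
# (cell ls-idea, seat ls-idea-lens-20 gen 2, card K-L20-3 §8; the seat's `Sketch_L20c_RogueForm.lean` v9 sha16
# 671fa81e2ab579b3 §1, §2, §7 (O1) and §8; critic E b8 PASS as INDEPENDENCE CERTIFICATE + LEDGER, «(O1)
# `singleFormBound_of_momentsBeyondDiagonal` is a clean deck candidate»; LANDING NOTE typer ls-idea-typ-1 gen 3: VERBATIM
# up to (i) namespace `.L20c` → `.Negation` (decks 14a–c), (ii) the selection (§1 + §2 + (O1) + §8 only — the rogue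
# construction / kill / preservation / `independence_true` are decks 14e–g), (iii) this header, (iv) two imports dropped.)

§1 TABLE WORLD: `FamTable` (index set, weights, Hecke tables, central jets) and the KMV displays / constraints of
   record (`MomentAsymptoticsFam`, `MassFam`, `PeterssonBoundFam`, `BettinFam`, `NonnegFam`) transported VERBATIM.
§2 DICTIONARY: `trueTable q` = `S₂(q)*`; every transported display on `trueTables` IS the tree display, so
   `momentsBeyondDiagonal_iff : MomentsBeyondDiagonal ↔ MomentsBeyondDiagonalFam trueTables` and the constraints of
   record on `trueTables` are literally `kmv2000_eq4` / `kowalskiMichel2000_peterssonBound` / `bettin2017_theorem11_primeLevel`.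
§7 (O1) / §8: `SingleFormBoundFam` / `SingleFormBound Δ'` (every form's harmonic share `ω_f ‖Λ(f,½) M_P(f,q̂^{Δ'})‖²` is
   `O(q̂/log² q̂)`); PROVED `singleFormBound_of_momentAsymptoticsFam` (positivity) and the pull-back
   `singleFormBound_of_momentsBeyondDiagonal : K_A → ∃ Δ > 1, ∀ Δ' ∈ (1, Δ], SingleFormBound Δ'` — NECESSARY for K_A
   over `S₂(q)*`; in print only for `Δ' < 1 + 4δ` via subconvexity (card A-L20-13); OPEN beyond.

HONESTY: tables ≠ `S₂(q)*` (REF-E (E5)); the dictionary lemmas are definitional unfoldings; nothing here proves K_A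
(stmt-Parity-20007), K_B, any moment asymptotic, any subconvexity bound, or any exceptional-zero theorem (no Landau–Siegel
/ Siegel-zero exclusion, no Theorem 1–2 of arXiv:2211.02515, no repaired Margin232); typed ≠ proved.
-/

noncomputable section

open scoped Real
open Finset Complex Polynomial CongruenceSubgroup
open Literature.NumberTheory.LFunctions
open Literature.NumberTheory.LFunctions.KMV2000
open Literature.NumberTheory.EllipticCurves.ModularForms

namespace Summit.Parity.GeneralizedHardyLittlewood.Theorems.PrimeLevelFamEdgeIdeaDeltas.Negation

universe u

/-! ## §1. The table world: verbatim transports of the KMV displays -/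

/-- A FAMILY TABLE at one level: a finite index set `S`, harmonic weights `w`, Hecke tables
`lam f : ℕ → ℂ` and central jets `jet f j = Λ^{(j)}(f, ½)`. -/
structure FamTable (α : Type u) where
  S : Finset α
  w : α → ℝ
  lam : α → ℕ → ℂ
  jet : α → ℕ → ℂ

/-- Tables along the levels (one table per level `q ≥ 1`). -/
def Tables (α : ℕ → Type u) : Type u := ∀ (q : ℕ) [NeZero q], FamTable (α q)

namespace FamTable

variable {α : Type u}

/-- The transported harmonic average `Σʰ_f g(f) := Σ_{f ∈ S} w_f g(f)`. -/
def hsum (T : FamTable α) (g : α → ℂ) : ℂ := ∑ f ∈ T.S, (T.w f : ℂ) * g f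

/-- The transported harmonic mass `Σʰ_f 1`. -/
def mass (T : FamTable α) : ℝ := ∑ f ∈ T.S, T.w f

/-- Non-negative harmonic weights. -/
def NonnegWeights (T : FamTable α) : Prop := ∀ f ∈ T.S, 0 ≤ T.w f

/-- The transported harmonic average is additive. -/
theorem hsum_add (T : FamTable α) (g h : α → ℂ) :
    T.hsum (fun f ↦ g f + h f) = T.hsum g + T.hsum h := by
  simp only [hsum, mul_add, Finset.sum_add_distrib]

/-- The transported harmonic average of a real table is real. -/
theorem hsum_ofReal (T : FamTable α) (r : α → ℝ) :
    T.hsum (fun f ↦ ((r f : ℝ) : ℂ)) = ((∑ f ∈ T.S, T.w f * r f : ℝ) : ℂ) := by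
  simp only [hsum]
  push_cast
  rfl

/-- Non-negative weights and a non-negative real table give a non-negative average. -/
theorem re_hsum_ofReal_nonneg (T : FamTable α) (hT : T.NonnegWeights) {r : α → ℝ}
    (hr : ∀ f ∈ T.S, 0 ≤ r f) : 0 ≤ (T.hsum (fun f ↦ ((r f : ℝ) : ℂ))).re := by
  rw [hsum_ofReal, Complex.ofReal_re]
  exact Finset.sum_nonneg fun f hf ↦ mul_nonneg (hT f hf) (hr f hf)

end FamTable

variable {α : Type u}

/-- Transported KMV mollifier (9): `M_P(f) = Σ_{m ≤ M} λ_f(m) μ(m) ψ(m)⁻¹ m^{-1/2} P(log(M/m)/log M)`. -/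
def mollF (T : FamTable α) (P : ℝ[X]) (M : ℝ) (f : α) : ℂ :=
  ∑ m ∈ Icc 1 ⌊M⌋₊, T.lam f m * (ArithmeticFunction.moebius m : ℂ) *
    (((psi m)⁻¹ * (m : ℝ) ^ (-(1 / 2 : ℝ)) * P.eval (Real.log (M / m) / Real.log M) : ℝ) : ℂ)

/-- Transported `Q̃(Λ(f,s))(½) = Σ_j a_j (log q̂)^{-j} Λ^{(j)}(f, ½)`. -/
def QtildeF (q : ℕ) [NeZero q] (T : FamTable α) (Q : ℝ[X]) (f : α) : ℂ :=
  ∑ j ∈ range (Q.natDegree + 1),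
    (Q.coeff j : ℂ) * (((Real.log (qhat q))⁻¹ : ℝ) : ℂ) ^ j * T.jet f j

/-- Transported first display `L^h(P,Q)`. -/
def LhF (q : ℕ) [NeZero q] (T : FamTable α) (P Q : ℝ[X]) (M : ℝ) : ℂ :=
  T.hsum (fun f ↦ QtildeF q T Q f * mollF T P M f)

/-- Transported second display `Q^h(P,Q)`. -/
def QhF (q : ℕ) [NeZero q] (T : FamTable α) (P Q : ℝ[X]) (M : ℝ) : ℂ :=
  T.hsum (fun f ↦ ((‖QtildeF q T Q f * mollF T P M f‖ ^ 2 : ℝ) : ℂ))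

/-- Transported Petersson pair sum `Σʰ λ_f(m) λ_f(n)` (the tree's `KowalskiMichel2000.pet`). -/
def petF (T : FamTable α) (m n : ℕ) : ℂ := T.hsum (fun f ↦ T.lam f m * T.lam f n)

/-- Transported central value `L(½,f) = Λ(f,½) / q̂^{1/2}` (the tree's `completedL_half`). -/
def centralF (q : ℕ) [NeZero q] (T : FamTable α) (f : α) : ℂ :=
  T.jet f 0 / (((qhat q : ℝ) : ℂ) ^ (1 / 2 : ℂ))

/-- Transported twisted first moment `Σʰ λ_f(m) L(½,f)` (Bettin's `𝓜_m`). -/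
def twistedFirstF (q : ℕ) [NeZero q] (T : FamTable α) (m : ℕ) : ℂ :=
  T.hsum (fun f ↦ T.lam f m * centralF q T f)

variable {β : ℕ → Type u}

/-- VERBATIM transport of `KMV2000.MomentAsymptotics Δlo Δhi T₁ T₂` to a family of tables. -/
def MomentAsymptoticsFam (𝓕 : Tables β) (Δlo Δhi : ℝ) (T₁ T₂ : ℝ → ℝ[X] → ℝ[X] → ℝ) : Prop :=
  ∀ P Q : ℝ[X], KMV2000.Admissible P → IsEvenOrOdd Q → ∀ Δ : ℝ, Δlo < Δ → Δ ≤ Δhi →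
    ∃ C : ℝ, ∃ q₀ : ℕ, ∀ (q : ℕ) [NeZero q], q.Prime → q₀ ≤ q →
      (∀ n : ℕ, (n : ℝ) ≠ qhat q ^ Δ) →
        ‖LhF q (𝓕 q) P Q (qhat q ^ Δ) -
            ((riemannZeta 2 * ((Real.sqrt (qhat q) / (Δ * Real.log (qhat q)) : ℝ) : ℂ)) *
              ((KMV2000.linForm Δ P Q + T₁ Δ P Q : ℝ) : ℂ))‖ ≤
          C * Real.sqrt (qhat q) * (Real.log (qhat q))⁻¹ ^ 2 ∧
        ‖QhF q (𝓕 q) P Q (qhat q ^ Δ) -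
            ((2 * riemannZeta 2 ^ 2 * ((qhat q / (Δ ^ 2 * Real.log (qhat q) ^ 2) : ℝ) : ℂ)) *
              ((KMV2000.secondMomentForm Δ P Q + T₂ Δ P Q : ℝ) : ℂ))‖ ≤
          C * qhat q * (Real.log (qhat q))⁻¹ ^ 3

/-- Transported K_A: `∃ Δ > 1, ∃ T₁ T₂, MomentAsymptoticsFam 𝓕 1 Δ T₁ T₂`. -/
def MomentsBeyondDiagonalFam (𝓕 : Tables β) : Prop :=
  ∃ Δ : ℝ, 1 < Δ ∧ ∃ T₁ T₂ : ℝ → ℝ[X] → ℝ[X] → ℝ, MomentAsymptoticsFam 𝓕 1 Δ T₁ T₂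

/-- Transported `kmv2000_eq4`: `Σʰ 1 = 1 + O(q^{-3/2})`. -/
def MassFam (𝓕 : Tables β) : Prop :=
  ∃ C : ℝ, ∀ (q : ℕ) [NeZero q], q.Prime → |(𝓕 q).mass - 1| ≤ C * (q : ℝ) ^ (-(3 / 2 : ℝ))

/-- Transported `kowalskiMichel2000_peterssonBound` (Petersson BOUND in its range). -/
def PeterssonBoundFam (𝓕 : Tables β) : Prop :=
  ∀ ε : ℝ, 0 < ε → ∃ C : ℝ, ∀ (q : ℕ) [NeZero q], q.Prime → ∀ m n : ℕ, 1 ≤ m → 1 ≤ n →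
    ¬ (q ∣ m ∧ q ∣ n) →
      ‖petF (𝓕 q) m n - (if m = n then 1 else 0)‖ ≤
        C * (((m : ℝ) * n) ^ (1 / 2 + ε)) * (q : ℝ) ^ (-(3 / 2 : ℝ))

/-- Transported `bettin2017_theorem11_primeLevel` (first moment beyond the diagonal, `T₁ = 0`). -/
def BettinFam (𝓕 : Tables β) : Prop :=
  ∀ ε : ℝ, 0 < ε → ∃ C : ℝ, ∃ N₀ : ℕ, ∀ (N : ℕ) [NeZero N], N.Prime → N₀ ≤ N → ∀ m : ℕ, 1 ≤ m →
    ‖twistedFirstF N (𝓕 N) m - (((m : ℝ) ^ (-(1 / 2 : ℝ)) : ℝ) : ℂ)‖ ≤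
      C * (m : ℝ) ^ (1 / 2 : ℝ) * (N : ℝ) ^ (-1 + ε)

/-- Non-negative weights at every level. -/
def NonnegFam (𝓕 : Tables β) : Prop := ∀ (q : ℕ) [NeZero q], (𝓕 q).NonnegWeights

/-! ## §2. The dictionary: the true family is a table, and K_A is the table statement on it -/

/-- The TRUE family at level `q` as a table: newforms `S₂(q)*`, harmonic weights, Hecke
eigenvalues, central jets of the completed `L`-function. -/
def trueTable (q : ℕ) [NeZero q] : FamTable (CuspForm (Gamma0 q) 2) where
  S := (finite_newforms0_holds q 2).toFinset
  w := fun f ↦ GL2Family.harmonicWeight f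
  lam := fun f m ↦ GL2Family.heckeLambda f m
  jet := fun f j ↦ derivLambda q j f

/-- The true family along the levels. -/
def trueTables : Tables (fun q ↦ CuspForm (Gamma0 q) 2) := fun q _ ↦ trueTable q

/-- `trueTables q` unfolds to `trueTable q`. -/
@[simp] theorem trueTables_apply (q : ℕ) [NeZero q] : trueTables q = trueTable q := rfl

section Dictionary

variable (q : ℕ) [NeZero q]

/-- DICTIONARY: the transported harmonic average on the true table is the tree's `harmonicSum`. -/
theorem hsum_true (g : CuspForm (Gamma0 q) 2 → ℂ) :
    (trueTable q).hsum g = GL2Family.harmonicSum q 2 g := by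
  rw [GL2Family.harmonicSum_def, finsum_mem_eq_finite_toFinset_sum _ (finite_newforms0_holds q 2)]
  rfl

/-- DICTIONARY: `mollF` on the true table is `KMV2000.mollifierP`. -/
theorem mollF_true (P : ℝ[X]) (M : ℝ) (f : CuspForm (Gamma0 q) 2) :
    mollF (trueTable q) P M f = mollifierP q P M f := rfl

/-- DICTIONARY: `QtildeF` on the true table is `KMV2000.Qtilde`. -/
theorem QtildeF_true (Q : ℝ[X]) (f : CuspForm (Gamma0 q) 2) :
    QtildeF q (trueTable q) Q f = Qtilde q Q f := rfl

/-- DICTIONARY: `LhF` on the true table is `KMV2000.LhPQ`. -/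
theorem LhF_true (P Q : ℝ[X]) (M : ℝ) : LhF q (trueTable q) P Q M = LhPQ q P Q M := by
  unfold LhF LhPQ
  rw [hsum_true]
  rfl

/-- DICTIONARY: `QhF` on the true table is `KMV2000.QhPQ`. -/
theorem QhF_true (P Q : ℝ[X]) (M : ℝ) : QhF q (trueTable q) P Q M = QhPQ q P Q M := by
  unfold QhF QhPQ
  rw [hsum_true]
  rfl

/-- DICTIONARY: `petF` on the true table is `KowalskiMichel2000.pet`. -/
theorem petF_true (m n : ℕ) : petF (trueTable q) m n = KowalskiMichel2000.pet q m n := by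
  unfold petF KowalskiMichel2000.pet
  rw [hsum_true]
  rfl

/-- DICTIONARY: `centralF` on the true table is the tree's central value `L(½,f)`. -/
theorem centralF_true (f : CuspForm (Gamma0 q) 2) :
    centralF q (trueTable q) f = IwaniecSarnak.centralValue f := by
  unfold centralF
  have hq : 0 < qhat q := qhat_pos (NeZero.one_le)
  have hne : (((qhat q : ℝ) : ℂ) ^ (1 / 2 : ℂ)) ≠ 0 := by
    rw [Ne, Complex.cpow_eq_zero_iff, not_and_or]
    left
    exact_mod_cast hq.ne'
  change derivLambda q 0 f / _ = _
  rw [derivLambda, iteratedDeriv_zero, completedL_half, mul_div_assoc, mul_div_cancel₀ _ hne]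

/-- DICTIONARY: `twistedFirstF` on the true table is Bettin's twisted first moment of the tree. -/
theorem twistedFirstF_true (m : ℕ) :
    twistedFirstF q (trueTable q) m =
      GL2Family.harmonicSum q 2
        (fun f ↦ GL2Family.heckeLambda f m * IwaniecSarnak.centralValue f) := by
  unfold twistedFirstF
  rw [hsum_true]
  congr 1
  funext f
  rw [centralF_true]
  rfl

/-- DICTIONARY: the transported mass of the true table is the tree's harmonic mass `Σʰ 1`. -/
theorem mass_true :
    (trueTable q).mass = IwaniecSarnak.harmonicSum q 2 (fun _ ↦ (1 : ℝ)) := by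
  rw [IwaniecSarnak.harmonicSum_one_eq (finite_newforms0_holds q 2)]
  unfold FamTable.mass trueTable
  refine Finset.sum_congr rfl fun f _ ↦ ?_
  exact KowalskiMichel2000.harmonicWeight_eq f

end Dictionary

/-- DICTIONARY: the typed K_A display is the table display on the true family. -/
theorem momentAsymptoticsFam_true_iff (Δlo Δhi : ℝ) (T₁ T₂ : ℝ → ℝ[X] → ℝ[X] → ℝ) :
    MomentAsymptoticsFam trueTables Δlo Δhi T₁ T₂ ↔ MomentAsymptotics Δlo Δhi T₁ T₂ := by
  simp only [MomentAsymptoticsFam, MomentAsymptotics, trueTables_apply, LhF_true, QhF_true]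

/-- DICTIONARY: the route crux K_A `MomentsBeyondDiagonal` IS `MomentsBeyondDiagonalFam trueTables`. -/
theorem momentsBeyondDiagonal_iff :
    Theses.PrimeLevelFamEdge.MomentsBeyondDiagonal ↔ MomentsBeyondDiagonalFam trueTables := by
  simp only [Theses.PrimeLevelFamEdge.MomentsBeyondDiagonal, MomentsBeyondDiagonalFam,
    momentAsymptoticsFam_true_iff]

/-- DICTIONARY: transported harmonic mass on the true family IS `kmv2000_eq4`. -/
theorem massFam_true_iff : MassFam trueTables ↔ kmv2000_eq4 := by
  simp only [MassFam, kmv2000_eq4, trueTables_apply, mass_true]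

/-- DICTIONARY: transported Petersson bound on the true family IS `kowalskiMichel2000_peterssonBound`. -/
theorem peterssonBoundFam_true_iff :
    PeterssonBoundFam trueTables ↔ KowalskiMichel2000.kowalskiMichel2000_peterssonBound := by
  simp only [PeterssonBoundFam, KowalskiMichel2000.kowalskiMichel2000_peterssonBound,
    trueTables_apply, petF_true]

/-- DICTIONARY: transported Bettin first moment on the true family IS `bettin2017_theorem11_primeLevel`. -/
theorem bettinFam_true_iff : BettinFam trueTables ↔ bettin2017_theorem11_primeLevel := by
  simp only [BettinFam, bettin2017_theorem11_primeLevel, trueTables_apply, twistedFirstF_true]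

/-- DICTIONARY: the true family has non-negative harmonic weights (PROVED in the tree). -/
theorem nonnegFam_true : NonnegFam trueTables := by
  intro q _ f _
  exact harmonicWeight_nonneg_two f


/-! ## §7 (O1). The SINGLE-FORM MOLLIFIED BOUND — NECESSARY for K_A^F under non-negative weights (positivity);
violated maximally by the rogue form (decks 14e–g); in `S₂(q)*` known only for `Δ' < 1 + 4δ` (subconvexity, pencil). -/


/-- (O1) The single-form mollified bound at logarithmic length `Δ'` (`Q = 1`). -/
def SingleFormBoundFam (𝓕 : Tables β) (Δ' : ℝ) : Prop :=
  ∀ P : ℝ[X], KMV2000.Admissible P → ∃ C : ℝ, ∃ q₀ : ℕ, ∀ (q : ℕ) [NeZero q], q.Prime → q₀ ≤ q →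
    (∀ n : ℕ, (n : ℝ) ≠ qhat q ^ Δ') → ∀ f ∈ (𝓕 q).S,
      (𝓕 q).w f * ‖QtildeF q (𝓕 q) 1 f * mollF (𝓕 q) P (qhat q ^ Δ') f‖ ^ 2 ≤
        C * qhat q * (Real.log (qhat q))⁻¹ ^ 2

/-- (O1) is NECESSARY: `MomentAsymptoticsFam 𝓕 1 Δ T₁ T₂` with non-negative weights forces the
single-form mollified bound at every `Δ' ∈ (1, Δ]` (positivity: one term ≤ the harmonic sum). -/
theorem singleFormBound_of_momentAsymptoticsFam (𝓕 : Tables β) (h𝓕 : NonnegFam 𝓕) {Δ : ℝ}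
    (T₁ T₂ : ℝ → ℝ[X] → ℝ[X] → ℝ) (h : MomentAsymptoticsFam 𝓕 1 Δ T₁ T₂) {Δ' : ℝ}
    (h1 : 1 < Δ') (h2 : Δ' ≤ Δ) : SingleFormBoundFam 𝓕 Δ' := by
  intro P hP
  obtain ⟨C, q₀, hC⟩ := h P 1 hP isEvenOrOdd_one Δ' h1 h2
  have hΔ'pos : 0 < Δ' := by linarith
  obtain ⟨K, hK_def⟩ : ∃ K : ℝ, K = ‖(2 : ℂ) * riemannZeta 2 ^ 2‖ * (1 / Δ' ^ 2) *
      |KMV2000.secondMomentForm Δ' P 1 + T₂ Δ' P 1| := ⟨_, rfl⟩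
  have hK0 : 0 ≤ K := by rw [hK_def]; positivity
  refine ⟨K + |C|, max q₀ 300, fun q _ hq hq₀ hgood f hf ↦ ?_⟩
  have hq₀' : q₀ ≤ q := le_trans (le_max_left _ _) hq₀
  have hq300 : 300 ≤ q := le_trans (le_max_right _ _) hq₀
  have hq40 : 40 ≤ q := by omega
  have hqhat1 : 1 < qhat q := one_lt_qhat hq40
  have hqhatpos : 0 < qhat q := by linarith
  have hlog1 : 1 ≤ Real.log (qhat q) := one_le_log_qhat hq300
  have hLpos : 0 < Real.log (qhat q) := by linarith
  obtain ⟨_, h2⟩ := hC q hq hq₀' hgood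
  obtain ⟨M, hM_def⟩ : ∃ M : ℝ, M = qhat q ^ Δ' := ⟨_, rfl⟩
  rw [← hM_def] at h2 ⊢
  obtain ⟨MAIN, hMAIN_def⟩ : ∃ MAIN : ℂ, MAIN =
      (2 * riemannZeta 2 ^ 2 * ((qhat q / (Δ' ^ 2 * Real.log (qhat q) ^ 2) : ℝ) : ℂ)) *
        ((KMV2000.secondMomentForm Δ' P 1 + T₂ Δ' P 1 : ℝ) : ℂ) := ⟨_, rfl⟩
  rw [← hMAIN_def] at h2
  -- one term ≤ the sum = Re Q^h
  have hterm : (𝓕 q).w f * ‖QtildeF q (𝓕 q) 1 f * mollF (𝓕 q) P M f‖ ^ 2 ≤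
      (QhF q (𝓕 q) P 1 M).re := by
    unfold QhF
    rw [FamTable.hsum_ofReal, Complex.ofReal_re]
    exact Finset.single_le_sum
      (f := fun g ↦ (𝓕 q).w g * ‖QtildeF q (𝓕 q) 1 g * mollF (𝓕 q) P M g‖ ^ 2)
      (fun g hg ↦ mul_nonneg (h𝓕 q g hg) (sq_nonneg _)) hf
  -- Re Q^h ≤ ‖MAIN‖ + error
  have hre : (QhF q (𝓕 q) P 1 M).re ≤ ‖MAIN‖ + C * qhat q * (Real.log (qhat q))⁻¹ ^ 3 := by
    have := Complex.re_le_norm (QhF q (𝓕 q) P 1 M)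
    have htri : ‖QhF q (𝓕 q) P 1 M‖ ≤ ‖MAIN‖ + ‖QhF q (𝓕 q) P 1 M - MAIN‖ := by
      have := norm_add_le MAIN (QhF q (𝓕 q) P 1 M - MAIN)
      rwa [add_sub_cancel] at this
    linarith
  have hMAIN : ‖MAIN‖ ≤ K * qhat q * (Real.log (qhat q))⁻¹ ^ 2 := by
    rw [hMAIN_def, norm_mul, norm_mul, Complex.norm_real, Complex.norm_real, Real.norm_eq_abs,
      Real.norm_eq_abs,
      abs_of_nonneg (by positivity : 0 ≤ qhat q / (Δ' ^ 2 * Real.log (qhat q) ^ 2))]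
    have : qhat q / (Δ' ^ 2 * Real.log (qhat q) ^ 2) =
        qhat q * (Real.log (qhat q))⁻¹ ^ 2 * (1 / Δ' ^ 2) := by
      field_simp
    rw [this, hK_def]
    exact le_of_eq (by ring)
  have herr : C * qhat q * (Real.log (qhat q))⁻¹ ^ 3 ≤ |C| * qhat q * (Real.log (qhat q))⁻¹ ^ 2 := by
    have hl0 : 0 ≤ (Real.log (qhat q))⁻¹ := inv_nonneg.mpr hLpos.le
    have hl1 : (Real.log (qhat q))⁻¹ ≤ 1 := inv_le_one_of_one_le₀ hlog1
    have h32 : (Real.log (qhat q))⁻¹ ^ 3 ≤ (Real.log (qhat q))⁻¹ ^ 2 :=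
      pow_le_pow_of_le_one hl0 hl1 (by norm_num)
    have hA : 0 ≤ qhat q * (Real.log (qhat q))⁻¹ ^ 3 := by positivity
    calc C * qhat q * (Real.log (qhat q))⁻¹ ^ 3 = C * (qhat q * (Real.log (qhat q))⁻¹ ^ 3) := by ring
      _ ≤ |C| * (qhat q * (Real.log (qhat q))⁻¹ ^ 3) :=
          mul_le_mul_of_nonneg_right (le_abs_self C) hA
      _ = |C| * qhat q * (Real.log (qhat q))⁻¹ ^ 3 := by ring
      _ ≤ |C| * qhat q * (Real.log (qhat q))⁻¹ ^ 2 :=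
          mul_le_mul_of_nonneg_left h32 (by positivity)
  calc (𝓕 q).w f * ‖QtildeF q (𝓕 q) 1 f * mollF (𝓕 q) P M f‖ ^ 2
      ≤ ‖MAIN‖ + C * qhat q * (Real.log (qhat q))⁻¹ ^ 3 := hterm.trans hre
    _ ≤ K * qhat q * (Real.log (qhat q))⁻¹ ^ 2 + |C| * qhat q * (Real.log (qhat q))⁻¹ ^ 2 :=
        add_le_add hMAIN herr
    _ = (K + |C|) * qhat q * (Real.log (qhat q))⁻¹ ^ 2 := by ring


/-! ## §8. (O1) over `S₂(q)*`: the route crux K_A entails the per-newform mollified bound (the table-world necessary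
condition pulled back through the dictionary; a statement about `S₂(q)*`, NOT about tables). -/

/-- (O1) over the TRUE family, in tree terms: at logarithmic length `Δ'`, every newform's harmonic
share `ω_f ‖Λ(f,½) M_P(f, q̂^{Δ'})‖²` of KMV's second display (`Q = 1`) is `O(q̂ / log² q̂)`. -/
def SingleFormBound (Δ' : ℝ) : Prop :=
  ∀ P : ℝ[X], KMV2000.Admissible P → ∃ C : ℝ, ∃ q₀ : ℕ, ∀ (q : ℕ) [NeZero q], q.Prime → q₀ ≤ q →
    (∀ n : ℕ, (n : ℝ) ≠ qhat q ^ Δ') → ∀ f ∈ (finite_newforms0_holds q 2).toFinset,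
      GL2Family.harmonicWeight f * ‖Qtilde q 1 f * mollifierP q P (qhat q ^ Δ') f‖ ^ 2 ≤
        C * qhat q * (Real.log (qhat q))⁻¹ ^ 2

/-- DICTIONARY: (O1) over `S₂(q)*` IS the table statement on `trueTables` (an unfolding). -/
theorem singleFormBound_iff_fam (Δ' : ℝ) : SingleFormBound Δ' ↔ SingleFormBoundFam trueTables Δ' :=
  Iff.rfl

/-- **K_A ⇒ (O1) on its window** (over `S₂(q)*`; positivity of the harmonic weights,
`harmonicWeight_nonneg_two`, is the only input besides K_A). -/
theorem singleFormBound_of_momentsBeyondDiagonal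
    (h : Theses.PrimeLevelFamEdge.MomentsBeyondDiagonal) :
    ∃ Δ : ℝ, 1 < Δ ∧ ∀ Δ' : ℝ, 1 < Δ' → Δ' ≤ Δ → SingleFormBound Δ' := by
  obtain ⟨Δ, hΔ, T₁, T₂, hMA⟩ := momentsBeyondDiagonal_iff.mp h
  exact ⟨Δ, hΔ, fun Δ' h1 h2 ↦ (singleFormBound_iff_fam Δ').mpr
    (singleFormBound_of_momentAsymptoticsFam trueTables nonnegFam_true T₁ T₂ hMA h1 h2)⟩

/-- The same with the window made explicit: `MomentAsymptotics 1 Δ T₁ T₂ → SingleFormBound Δ'` for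
every `Δ' ∈ (1, Δ]`, whatever the level-free pair `(T₁, T₂)`. -/
theorem singleFormBound_of_momentAsymptotics {Δ : ℝ} (T₁ T₂ : ℝ → ℝ[X] → ℝ[X] → ℝ)
    (h : MomentAsymptotics 1 Δ T₁ T₂) {Δ' : ℝ} (h1 : 1 < Δ') (h2 : Δ' ≤ Δ) : SingleFormBound Δ' :=
  (singleFormBound_iff_fam Δ').mpr
    (singleFormBound_of_momentAsymptoticsFam trueTables nonnegFam_true T₁ T₂
      ((momentAsymptoticsFam_true_iff 1 Δ T₁ T₂).mpr h) h1 h2)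

end Summit.Parity.GeneralizedHardyLittlewood.Theorems.PrimeLevelFamEdgeIdeaDeltas.Negation

end
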